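import Literature.IUT.LogThetaLattice.StripFrameOfKits
import Literature.IUT.LogThetaLattice.LogLink

/-!
# `LogStripData.ofKits`: the log-link functor `†𝔉 ↦ log(†𝔉)` of [IUTchIII] Def 1.1 over the assembled frame, from a per-place log-Frobenius datum

Mochizuki, *Inter-universal Teichmüller Theory III*, kurims manuscript (May 2020), Def 1.1 (i)–(iii) pp. 23–27,
Rmk 1.1.2 (i) p. 29; [AbsTopIII] Def 3.1 (iv) (the log-Frobenius functor `𝔩𝔬𝔤`).
([IUTchIII] Def 1.1 (iii) p.26) [claim: Mochizuki2012, status: disputed]. MERGE BRIDGE (plan/L6/MERGE-MAP.md row 46 / B10 part 2,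
sequel), consumer seat abc-iut-L6-t3. Nothing of the series is asserted.

[IUTchIII] Def 1.1 (i)–(ii) construct, for each `v ∈ V̲`, from the local datum `†ℱ_v` of an `ℱ`-prime-strip a new local
datum `log(†ℱ_v)` (the `p_v`-adic / archimedean logarithm on `Ψ_{†ℱ_v}`: the concrete content is [AbsTopIII] §3–4,
abc-iut-L4-t2's log-Frobenius typings and this seat's `LocalLogShells` / `HolomorphicLogShells`); (iii) collects them:
"`log(†𝔉) := {log(†ℱ_v)}_{v∈V̲}`"; Rmk 1.1.2 (i): the arithmetic fundamental groups (the `𝒟`-prime-strip) of `log(†𝔉)`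
are TAUTOLOGICALLY those of `†𝔉`. The §1 interface `LogStripData S` (this seat, `LogLink.lean`) records exactly
`log : S.F ⥤ S.F` and `logD : log ⋙ S.toD ≅ S.toD`. Over the ASSEMBLED frame `StripFrame.ofKits` (abc-iut-L5-t4's
kits) this file reduces it to the honest per-place input:

* `LogKit FK` — for every `v`, an endofunctor `log v : FK.FAmb v ⥤ FK.FAmb v` of the ambient category of local data
  at `v` ([AbsTopIII] Def 3.1 (iv) "log-Frobenius functor"), preserving isomorphs of the model (`log_model`), with
  the tautological identification of base objects `log v ⋙ FK.toD v ≅ FK.toD v` (Rmk 1.1.2 (i)); TODO-merge: its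
  instantiation from abc-iut-L4-t2's MLF-Galois-pair log-Frobenius (`LogFrobeniusData.log`) / abc-iut-L5-t2's local
  Frobenioids is the owners' bridge;
* `LogKit.logStrip : FK.FStrip ⥤ FK.FStrip` ("`log(†𝔉) := {log(†ℱ_v)}_v`", componentwise on collections of
  isomorphisms) with `logStripD : logStrip ⋙ assocDFunctor ≅ assocDFunctor`;
* `LogStripData.ofKits : LogStripData (StripFrame.ofKits L hbij hsurj hR X)` — so that every §1 construction over
  `LogStripData` (`LogLink`, Prop 1.2 (i) `inducedD_full`, Prop 1.3 (i) `stripLogIso`, the lattice `LogThetaLatticeDiagram`,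
  Thm 1.5 (i)) instantiates over the kits.
-/

namespace Literature.IUT.LogThetaLattice

open CategoryTheory
open Literature.IUT.HodgeTheaters Literature.IUT.HodgeTheaters.PMBaseKit
open AsSmallTransport

universe u

variable {l : ℕ} {K : PMBaseKit.{u} l} {M : K.MultKit}

/-- **IUTchIII:Def1.1(i)** (kurims p.24) INPUT: a per-place LOG-FROBENIUS DATUM on abc-iut-L5-t4's `ℱ`-kit — for each `v ∈ V̲` an
endofunctor `†ℱ_v ↦ log(†ℱ_v)` of the ambient category of local data [Def 1.1 (i) nonarchimedean, (ii) archimedean;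
[AbsTopIII] Def 3.1 (iv)], carrying isomorphs of the model `ℱ_v` to isomorphs of the model ("`log(†ℱ_v)` … is, in
fact, naturally isomorphic to" an object of the same type, p.24), together with Rmk 1.1.2 (i)'s TAUTOLOGICAL
identification of base objects (`†Π_v` unchanged). TODO-merge: abc-iut-L4-t2 ([AbsTopIII] Def 3.1 log-Frobenius) /
abc-iut-L5-t2 (local Frobenioids). ([IUTchIII] Def 1.1 (i) p.24) [claim: Mochizuki2012, status: disputed] -/
structure LogKit (FK : K.FKit M) : Type (u + 1) where
  /-- `†ℱ_v ↦ log(†ℱ_v)` at each `v` -/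
  log : ∀ v, FK.FAmb v ⥤ FK.FAmb v
  /-- `log(ℱ_v)` is again an isomorph of the model `ℱ_v` -/
  log_model : ∀ v, Nonempty ((log v).obj (FK.fModel v) ≅ FK.fModel v)
  /-- Rmk 1.1.2 (i): the base object (`†𝒟_v`, i.e. `†Π_v`) of `log(†ℱ_v)` is that of `†ℱ_v`, naturally -/
  logD : ∀ v, log v ⋙ FK.toD v ≅ FK.toD v

namespace LogKit

variable {FK : K.FKit M} (LK : LogKit FK)

/-- **IUTchIII:Def1.1(iii)** (kurims p.26) "`log(†𝔉) := {log(†ℱ_v)}_{v∈V̲}` … the `ℱ`-prime-strip determined by the data `log(†ℱ_v)`":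
the componentwise functor on abc-iut-L5-t4's `ℱ`-prime-strips (morphisms = collections of isomorphisms, abc-iut-L6-t7's
groupoid). ([IUTchIII] Def 1.1 (iii) p.26) [claim: Mochizuki2012, status: disputed] -/
noncomputable def logStrip : FK.FStrip ⥤ FK.FStrip where
  obj F := ⟨fun v => (LK.log v).obj (F.obj v), fun v => ⟨(LK.log v).mapIso (F.isModel v).some ≪≫ (LK.log_model v).some⟩⟩
  map φ := fun v => (LK.log v).mapIso (φ v)
  map_id F := by funext v; exact (LK.log v).mapIso_refl _
  map_comp f g := by funext v; exact (LK.log v).mapIso_trans (f v) (g v)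

/-- **IUTchIII:Rmk1.1.2(i)** (kurims p.29) Rmk 1.1.2 (i) strip-wise: the `𝒟`-prime-strip of `log(†𝔉)` is that of `†𝔉`, naturally in `†𝔉`
("a tautological identification between the `†Π_v`'s … of the domain … and … the codomain").
([IUTchIII] Rmk 1.1.2 (i) p.29) [claim: Mochizuki2012, status: disputed] -/
noncomputable def logStripD :
    LK.logStrip ⋙ PrimeStripGroupoids.assocDFunctor FK ≅ PrimeStripGroupoids.assocDFunctor FK :=
  NatIso.ofComponents
    (fun F => (Groupoid.isoEquivHom _ _).symm (fun v => (LK.logD v).app (F.obj v)))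
    (fun {F₁ F₂} φ => by
      funext v
      change (FK.toD v).mapIso ((LK.log v).mapIso (φ v)) ≪≫ (LK.logD v).app (F₂.obj v) =
        (LK.logD v).app (F₁.obj v) ≪≫ (FK.toD v).mapIso (φ v)
      ext
      exact (LK.logD v).hom.naturality (φ v).hom)

/-- **IUTchIII:Def1.1(iii)** (kurims p.26) At each `v` the `v`-component of `log(†𝔉)` is `log(†ℱ_v)`. ([IUTchIII] Def 1.1 (iii) p.26) [claim: Mochizuki2012, status: disputed] -/
@[simp] theorem logStrip_obj_obj (F : FK.FStrip) (v : K.V) : (LK.logStrip.obj F).obj v = (LK.log v).obj (F.obj v) :=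
  rfl

end LogKit

section

variable {FK : K.FKit M} (L : FK.MonoLaws) (hbij : FK.IsomFtoDBijective) (hsurj : FK.IsomFmtoDmSurjective)
  (hR : FK.RlfOfIsStrip) (X : TimesMuSide FK L) (LK : LogKit FK)

/-- **IUTchIII:Def1.1(iii)** (kurims p.26) **`LogStripData.ofKits`**: the §1 log-strip interface (`log : F ⥤ F`, `logD : log ⋙ toD ≅ toD`)
INSTANTIATED over the assembled frame `StripFrame.ofKits` from a per-place log-Frobenius datum `LogKit` — after which
`LogLink`, `LogLink.full`, Prop 1.2 (i) (`LogLink.inducedD_full`), Prop 1.3 (i) (`stripLogIso`) and the log-theta-lattice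
diagram are available over abc-iut-L5-t4's kits. ([IUTchIII] Def 1.1 (iii) p.26) [claim: Mochizuki2012, status: disputed] -/
noncomputable def LogStripData.ofKits : LogStripData (StripFrame.ofKits L hbij hsurj hR X) where
  log := liftF LK.logStrip
  logD := liftTriangle LK.logStripD

/-- **IUTchIII:Def1.1(iii)** (kurims p.27) Consequently the FULL LOG-LINK `†𝔉 --log--> ‡𝔉` between any two (small models of) `ℱ`-prime-strips
of abc-iut-L5-t4's kit exists as a term of the §1 typing (Def 1.1 (iii)). ([IUTchIII] Def 1.1 (iii) p.27) [claim: Mochizuki2012, status: disputed] -/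
noncomputable def fullLogLinkOfKits (F₁ F₂ : (StripFrame.ofKits L hbij hsurj hR X).F) :
    LogLink (LogStripData.ofKits L hbij hsurj hR X LK) F₁ F₂ :=
  LogLink.full _ F₁ F₂

/-- **IUTchIII:Prop1.2(i)** (kurims p.31) Prop 1.2 (i) OVER THE KITS: the full log-link induces the FULL poly-isomorphism of associated
`𝒟`-prime-strips — an instance of this seat's `LogLink.inducedD_full`, now resting on abc-iut-L5-t4's NAMED Cor 5.3 (ii)
statement `hbij : FK.IsomFtoDBijective` (through `StripFrame.ofKits.toD_isoBij`). ([IUTchIII] Prop 1.2 (i) p.31) [claim: Mochizuki2012, status: disputed] -/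
theorem inducedD_full_ofKits (F₁ F₂ : (StripFrame.ofKits L hbij hsurj hR X).F) :
    (fullLogLinkOfKits L hbij hsurj hR X LK F₁ F₂).inducedD = PolyIso.full _ _ :=
  LogLink.inducedD_full _ F₁ F₂

end

end Literature.IUT.LogThetaLattice
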